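import Literature.AlgebraicGeometry.Modules.TensorSheafHomAdjunction
import Literature.AlgebraicGeometry.Modules.TensorAssociator
import Literature.AlgebraicGeometry.Modules.TensorBraiding
import Literature.AlgebraicGeometry.Modules.SheafHomLeft
import HarnessLib

/-!
# The internal curry `𝓗om(B₁ ⊗ B₂, C) ≅ 𝓗om(B₂, 𝓗om(B₁, C))` for `𝒪_X`-modules (Stacks 01CN)

Layer `Literature/AlgebraicGeometry/Modules` (one definition + its braided twin, 0 named facts, no instances, no
notation). For `𝒪_X`-modules `B₁`, `B₂`, `C` on a scheme `X` (Mathlib's `X.Modules`; the tree's sheafified tensor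
product `Modules.tensorObj`, Stacks 01CA, and internal Hom `Modules.sheafHom`, Stacks 01CM) we construct the
canonical isomorphism of `𝒪_X`-modules

  `sheafHomCurryIso B₁ B₂ C : 𝓗om(B₁ ⊗ B₂, C) ≅ 𝓗om(B₂, 𝓗om(B₁, C))`,

The Stacks Project, Tag 01CN (Lemma 17.22.3 in the current numbering, "Internal hom and tensor"): "Let
`(X, 𝒪_X)` be a ringed space. Let `𝓕, 𝓖, 𝓗` be `𝒪_X`-modules. There is a canonical isomorphism
`𝓗om_{𝒪_X}(𝓕 ⊗_{𝒪_X} 𝓖, 𝓗) → 𝓗om_{𝒪_X}(𝓕, 𝓗om_{𝒪_X}(𝓖, 𝓗))` which is functorial in all three entries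
(sheaf Hom in all three spots)"; Görtz–Wedhorn I (7.4.7) / Prop. 7.7. It is obtained by the YONEDA principle
from the tree's global tensor–hom adjunction `Hom(B ⊗ A, C) ≃ Hom(A, 𝓗om(B, C))`
(`Modules/TensorSheafHomAdjunction.tensorSheafHomEquiv`, Hartshorne II Ex. 5.1 (c)) and the associator of the tensor
product (`Modules/TensorAssociator.tensorAssoc`): for every test module `T`,

  `Hom(T, 𝓗om(B₁ ⊗ B₂, C)) ≃ Hom((B₁ ⊗ B₂) ⊗ T, C) ≃ Hom(B₁ ⊗ (B₂ ⊗ T), C) ≃ Hom(B₂ ⊗ T, 𝓗om(B₁, C))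
     ≃ Hom(T, 𝓗om(B₂, 𝓗om(B₁, C)))`,

naturally in `T` (`curryHom`, `uncurryHom`, `uncurryHom_curryHom`, `curryHom_uncurryHom`, `curryHom_comp`), whence
the isomorphism (Mathlib `Yoneda.ext`). Its universal property is `comp_sheafHomCurryIso_hom : φ ≫ hom = curryHom φ`;
it is natural in `C` (`sheafHomCurryIso_hom_naturality`); the braided twin
`sheafHomCurryIso' B₁ B₂ C : 𝓗om(B₁ ⊗ B₂, C) ≅ 𝓗om(B₁, 𝓗om(B₂, C))` (the printed order of 01CN) is obtained
through the symmetry `B₁ ⊗ B₂ ≅ B₂ ⊗ B₁` (`Modules/TensorBraiding.tensorComm`, `Modules/SheafHomLeft.sheafHomMapLeftIso`).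

Everything is a construction with a body or a proved lemma; no named fact. Library only (cell `pub-hodge-ring2`,
count-neutral module theory; proves nothing about any crux, route or conjecture).

## References

* The Stacks Project, Tag 01CN (Modules on ringed spaces, "Internal hom": the canonical isomorphism
  `𝓗om(𝓕 ⊗ 𝓖, 𝓗) ≅ 𝓗om(𝓕, 𝓗om(𝓖, 𝓗))`), Tag 01CM, Tag 01CA. [StacksProject]
* U. Görtz, T. Wedhorn, *Algebraic Geometry I: Schemes*, 2nd ed. (2020), (7.4.7) and Prop. 7.7 (adjointness of
  `⊗` and `𝓗om` for `𝒪_X`-modules). [GortzWedhorn2020]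
* R. Hartshorne, *Algebraic Geometry* (1977), II Ex. 5.1 (c). [Hartshorne1977]
-/

noncomputable section

-- `TopCat.Presheaf`/`Scheme.Modules` are not reducible (as in Mathlib's `AlgebraicGeometry/Modules/Sheaf.lean`).
set_option backward.isDefEq.respectTransparency false

open CategoryTheory AlgebraicGeometry

universe u

namespace Literature.AlgebraicGeometry.Modules

variable {X : Scheme.{u}}

/-! ### §1 Naturality of the global transposition in the tensored variable -/

section Naturality

variable {B A A' C : X.Modules}

/-- Naturality of `φ ↦ φ♯` in `A`: `((𝟙_B ⊗ f) ≫ φ)♯ = f ≫ φ♯` (the forward form of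
`tensorSheafHomEquiv_symm_naturality_left`). [cite: Hartshorne1977, II Ex. 5.1 (c)] [cite: StacksProject, Tag 01CN] -/
theorem tensorSheafHomEquiv_naturality_left (f : A' ⟶ A) (φ : tensorObj B A ⟶ C) :
    tensorSheafHomEquiv B A' C (tensorMap (𝟙 B) f ≫ φ) = f ≫ tensorSheafHomEquiv B A C φ := by
  apply (tensorSheafHomEquiv B A' C).symm.injective
  rw [Equiv.symm_apply_apply, tensorSheafHomEquiv_symm_naturality_left, Equiv.symm_apply_apply]

end Naturality

/-! ### §2 Currying and uncurrying a morphism into `𝓗om(B₁ ⊗ B₂, C)` -/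

section Curry

variable (B₁ B₂ C : X.Modules) {T T' : X.Modules}

/-- **Currying** a morphism `φ : T ⟶ 𝓗om(B₁ ⊗ B₂, C)`: transpose to `(B₁ ⊗ B₂) ⊗ T ⟶ C`, reassociate to
`B₁ ⊗ (B₂ ⊗ T) ⟶ C`, and transpose twice, to `T ⟶ 𝓗om(B₂, 𝓗om(B₁, C))`. [cite: StacksProject, Tag 01CN]
[cite: GortzWedhorn2020, (7.4.7)] -/
def curryHom (φ : T ⟶ sheafHom (tensorObj B₁ B₂) C) : T ⟶ sheafHom B₂ (sheafHom B₁ C) :=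
  tensorSheafHomEquiv B₂ T (sheafHom B₁ C)
    (tensorSheafHomEquiv B₁ (tensorObj B₂ T) C
      ((tensorAssoc B₁ B₂ T).inv ≫ (tensorSheafHomEquiv (tensorObj B₁ B₂) T C).symm φ))

/-- **Uncurrying** a morphism `ψ : T ⟶ 𝓗om(B₂, 𝓗om(B₁, C))`: the inverse three steps.
[cite: StacksProject, Tag 01CN] [cite: GortzWedhorn2020, (7.4.7)] -/
def uncurryHom (ψ : T ⟶ sheafHom B₂ (sheafHom B₁ C)) : T ⟶ sheafHom (tensorObj B₁ B₂) C :=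
  tensorSheafHomEquiv (tensorObj B₁ B₂) T C
    ((tensorAssoc B₁ B₂ T).hom ≫
      (tensorSheafHomEquiv B₁ (tensorObj B₂ T) C).symm ((tensorSheafHomEquiv B₂ T (sheafHom B₁ C)).symm ψ))

variable {B₁ B₂ C}

/-- `uncurry (curry φ) = φ`. [cite: StacksProject, Tag 01CN] -/
@[simp]
theorem uncurryHom_curryHom (φ : T ⟶ sheafHom (tensorObj B₁ B₂) C) :
    uncurryHom B₁ B₂ C (curryHom B₁ B₂ C φ) = φ := by
  simp only [curryHom, uncurryHom, Equiv.symm_apply_apply, Iso.hom_inv_id_assoc, Equiv.apply_symm_apply]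

/-- `curry (uncurry ψ) = ψ`. [cite: StacksProject, Tag 01CN] -/
@[simp]
theorem curryHom_uncurryHom (ψ : T ⟶ sheafHom B₂ (sheafHom B₁ C)) :
    curryHom B₁ B₂ C (uncurryHom B₁ B₂ C ψ) = ψ := by
  simp only [curryHom, uncurryHom, Equiv.symm_apply_apply, Iso.inv_hom_id_assoc, Equiv.apply_symm_apply]

/-- **Naturality of currying in the test object**: `curry (f ≫ φ) = f ≫ curry φ` (naturality of the
transpositions and of the associator). [cite: StacksProject, Tag 01CN] [cite: GortzWedhorn2020, (7.4.7)] -/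
theorem curryHom_comp (f : T' ⟶ T) (φ : T ⟶ sheafHom (tensorObj B₁ B₂) C) :
    curryHom B₁ B₂ C (f ≫ φ) = f ≫ curryHom B₁ B₂ C φ := by
  simp only [curryHom]
  rw [tensorSheafHomEquiv_symm_naturality_left, ← Category.assoc]
  have hα : (tensorAssoc B₁ B₂ T').inv ≫ tensorMap (𝟙 (tensorObj B₁ B₂)) f =
      tensorMap (𝟙 B₁) (tensorMap (𝟙 B₂) f) ≫ (tensorAssoc B₁ B₂ T).inv := by
    rw [Iso.inv_comp_eq, ← Category.assoc, Iso.eq_comp_inv, ← tensorMap_id, tensorAssoc_naturality]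
  rw [hα, Category.assoc, tensorSheafHomEquiv_naturality_left, tensorSheafHomEquiv_naturality_left]

/-- `curryHom` as an equivalence `Hom(T, 𝓗om(B₁ ⊗ B₂, C)) ≃ Hom(T, 𝓗om(B₂, 𝓗om(B₁, C)))`.
[cite: StacksProject, Tag 01CN] -/
def curryHomEquiv (T : X.Modules) :
    (T ⟶ sheafHom (tensorObj B₁ B₂) C) ≃ (T ⟶ sheafHom B₂ (sheafHom B₁ C)) where
  toFun := curryHom B₁ B₂ C
  invFun := uncurryHom B₁ B₂ C
  left_inv := uncurryHom_curryHom
  right_inv := curryHom_uncurryHom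

end Curry

/-! ### §3 The internal curry isomorphism -/

section Iso

variable (B₁ B₂ C : X.Modules) {T C' : X.Modules}

/-- **The internal curry `𝓗om(B₁ ⊗ B₂, C) ≅ 𝓗om(B₂, 𝓗om(B₁, C))`** (Stacks 01CN "sheaf Hom in all three spots";
Görtz–Wedhorn I (7.4.7)): the Yoneda isomorphism of the natural bijections `curryHom` / `uncurryHom`.
[cite: StacksProject, Tag 01CN] [cite: GortzWedhorn2020, (7.4.7)] -/
def sheafHomCurryIso : sheafHom (tensorObj B₁ B₂) C ≅ sheafHom B₂ (sheafHom B₁ C) :=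
  Yoneda.ext _ _ (curryHom B₁ B₂ C) (uncurryHom B₁ B₂ C) uncurryHom_curryHom curryHom_uncurryHom
    (curryHom_comp (B₁ := B₁) (B₂ := B₂) (C := C))

/-- The curry isomorphism is `curryHom` of the identity. [cite: StacksProject, Tag 01CN] -/
theorem sheafHomCurryIso_hom : (sheafHomCurryIso B₁ B₂ C).hom = curryHom B₁ B₂ C (𝟙 _) := rfl

/-- Its inverse is `uncurryHom` of the identity. [cite: StacksProject, Tag 01CN] -/
theorem sheafHomCurryIso_inv : (sheafHomCurryIso B₁ B₂ C).inv = uncurryHom B₁ B₂ C (𝟙 _) := rfl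

variable {B₁ B₂ C}

/-- **Universal property**: composing `φ : T ⟶ 𝓗om(B₁ ⊗ B₂, C)` with the curry isomorphism CURRIES `φ`.
[cite: StacksProject, Tag 01CN] [cite: GortzWedhorn2020, (7.4.7)] -/
theorem comp_sheafHomCurryIso_hom (φ : T ⟶ sheafHom (tensorObj B₁ B₂) C) :
    φ ≫ (sheafHomCurryIso B₁ B₂ C).hom = curryHom B₁ B₂ C φ := by
  rw [sheafHomCurryIso_hom, ← curryHom_comp, Category.comp_id]

/-- Dually, composing `ψ : T ⟶ 𝓗om(B₂, 𝓗om(B₁, C))` with the inverse UNCURRIES `ψ`. [cite: StacksProject, Tag 01CN] -/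
theorem comp_sheafHomCurryIso_inv (ψ : T ⟶ sheafHom B₂ (sheafHom B₁ C)) :
    ψ ≫ (sheafHomCurryIso B₁ B₂ C).inv = uncurryHom B₁ B₂ C ψ := by
  rw [Iso.comp_inv_eq, comp_sheafHomCurryIso_hom, curryHom_uncurryHom]

/-- Naturality of currying in `C`: `curry (φ ≫ 𝓗om(B₁ ⊗ B₂, g)) = curry φ ≫ 𝓗om(B₂, 𝓗om(B₁, g))`.
[cite: StacksProject, Tag 01CN] -/
theorem curryHom_comp_sheafHomMap (φ : T ⟶ sheafHom (tensorObj B₁ B₂) C) (g : C ⟶ C') :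
    curryHom B₁ B₂ C' (φ ≫ sheafHomMap (tensorObj B₁ B₂) g) =
      curryHom B₁ B₂ C φ ≫ sheafHomMap B₂ (sheafHomMap B₁ g) := by
  simp only [curryHom]
  have h₁ : (tensorSheafHomEquiv (tensorObj B₁ B₂) T C').symm (φ ≫ sheafHomMap (tensorObj B₁ B₂) g) =
      (tensorSheafHomEquiv (tensorObj B₁ B₂) T C).symm φ ≫ g := by
    apply (tensorSheafHomEquiv (tensorObj B₁ B₂) T C').injective
    rw [Equiv.apply_symm_apply, tensorSheafHomEquiv_naturality_right, Equiv.apply_symm_apply]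
  rw [h₁, ← Category.assoc, tensorSheafHomEquiv_naturality_right, tensorSheafHomEquiv_naturality_right]

/-- **Naturality of the internal curry in `C`** ("functorial in all three entries", here the covariant one):
`𝓗om(B₁ ⊗ B₂, g) ≫ curry = curry ≫ 𝓗om(B₂, 𝓗om(B₁, g))`. [cite: StacksProject, Tag 01CN] -/
theorem sheafHomCurryIso_hom_naturality (g : C ⟶ C') :
    sheafHomMap (tensorObj B₁ B₂) g ≫ (sheafHomCurryIso B₁ B₂ C').hom =
      (sheafHomCurryIso B₁ B₂ C).hom ≫ sheafHomMap B₂ (sheafHomMap B₁ g) := by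
  rw [comp_sheafHomCurryIso_hom, sheafHomCurryIso_hom, ← curryHom_comp_sheafHomMap, Category.id_comp]

/-- `Nonempty` form: the internal Hom out of a tensor product is an iterated internal Hom.
[cite: StacksProject, Tag 01CN] -/
theorem nonempty_sheafHom_tensorObj_iso (B₁ B₂ C : X.Modules) :
    Nonempty (sheafHom (tensorObj B₁ B₂) C ≅ sheafHom B₂ (sheafHom B₁ C)) :=
  ⟨sheafHomCurryIso B₁ B₂ C⟩

end Iso

/-! ### §4 The braided form `𝓗om(B₁ ⊗ B₂, C) ≅ 𝓗om(B₁, 𝓗om(B₂, C))` -/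

section Braided

variable (B₁ B₂ C : X.Modules)

/-- **The internal curry in the printed order of Stacks 01CN**, `𝓗om(𝓕 ⊗ 𝓖, 𝓗) ≅ 𝓗om(𝓕, 𝓗om(𝓖, 𝓗))`: through
the symmetry `B₁ ⊗ B₂ ≅ B₂ ⊗ B₁` of the tensor product and the curry isomorphism for `(B₂, B₁)`.
[cite: StacksProject, Tag 01CN] [cite: GortzWedhorn2020, (7.4.7)] -/
def sheafHomCurryIso' : sheafHom (tensorObj B₁ B₂) C ≅ sheafHom B₁ (sheafHom B₂ C) :=
  sheafHomMapLeftIso (tensorComm B₁ B₂) C ≪≫ sheafHomCurryIso B₂ B₁ C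

/-- Unfolding the braided form. [cite: StacksProject, Tag 01CN] -/
theorem sheafHomCurryIso'_hom :
    (sheafHomCurryIso' B₁ B₂ C).hom =
      sheafHomMapLeft (tensorComm B₁ B₂).inv C ≫ (sheafHomCurryIso B₂ B₁ C).hom := by
  rw [sheafHomCurryIso', Iso.trans_hom, sheafHomMapLeftIso_hom]

/-- `Nonempty` form of the printed statement of Stacks 01CN. [cite: StacksProject, Tag 01CN] -/
theorem nonempty_sheafHom_tensorObj_iso' (B₁ B₂ C : X.Modules) :
    Nonempty (sheafHom (tensorObj B₁ B₂) C ≅ sheafHom B₁ (sheafHom B₂ C)) :=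
  ⟨sheafHomCurryIso' B₁ B₂ C⟩

end Braided

end Literature.AlgebraicGeometry.Modules

end
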